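import Summits.CriticalPhenomena.SAWScalingLimit.Theorems.MassRatio.Negative.Brick

/-!
# Crux `MassRatio` (stmt-CriticalPhenomena-8550) — load-bearing hypotheses, part 22 (cycle 4): component restriction — towards "`Preconnected` is decoration"

Negative-series helper file (refuter, cdisprove). The cycle-4 reading "the `Preconnected` conjunct of the
crux's frame is DECORATION modulo the other hypotheses" rests on restricting an admissible `Λ_δ` to the
component of the root; this file machine-checks the combinatorial half of that restriction:

* `comp Λ w` (the `Λ`-component of `w`), `Linked.induct`, `linked_comp`, `preconnected_comp`;
* `verts_linked`, `toComp`, `ofSubdomain`, **`observable_comp_eq`**: from a root mid-edge `s(u,w)`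
  (`u ∉ Λ`, `w ∈ Λ`) the parafermionic observable of `Λ` and of `comp Λ w` coincide at every fugacity,
  spin and target (walks from the root never leave the component);
* **`simplyConnected_comp`**: simple connectivity (connected complement) passes to the component (walk
  right along a row until the finite `Λ` is left);
* `root_mem_boundary_comp`, `target_mem_boundary_comp`, `nonempty_saw_comp`.

The two geometric blocks still missing for the full decoration theorem (rows clause and exhaustion pass
to the component: linkage of the discrete half-ball, linkage of `K_δ` to it through a thickened compact
connected set) are recorded as near-misses in the crux workfile `Cruxes/MassRatio/DisproofComponent.lean`.
-/

namespace Summit.CriticalPhenomena.SAWScalingLimit.Theorems.MassRatio.Negative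

open Literature.Probability.LatticeModels Literature.Probability.RandomPlanarGeometry.SAW
open Literature.Probability.RandomPlanarGeometry

/-! ### M.1 Components -/

/-- The `Λ`-component of `w`: the vertices of `Λ` linked to `w` inside `Λ`. [folklore] -/
noncomputable def comp (Λ : Finset HexVertex) (w : HexVertex) : Finset HexVertex := by
  classical exact Λ.filter (fun v => Linked (↑Λ : Set HexVertex) w v)

/-- Membership in the component. [folklore] -/
theorem mem_comp {Λ : Finset HexVertex} {w v : HexVertex} :
    v ∈ comp Λ w ↔ v ∈ Λ ∧ Linked (↑Λ : Set HexVertex) w v := by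
  classical
  unfold comp; rw [Finset.mem_filter]

/-- The component is a sub-domain. [folklore] -/
theorem comp_subset (Λ : Finset HexVertex) (w : HexVertex) : comp Λ w ⊆ Λ := fun _ hv =>
  (mem_comp.1 hv).1

/-- `w` lies in its component. [folklore] -/
theorem self_mem_comp {Λ : Finset HexVertex} {w : HexVertex} (hw : w ∈ Λ) : w ∈ comp Λ w :=
  mem_comp.2 ⟨hw, Linked.refl (by exact_mod_cast hw)⟩

/-- Induction along linkage: a property of `u` that propagates along edges of `S` holds at every
vertex linked to `u`. [folklore] -/
theorem Linked.induct {S : Set HexVertex} {P : HexVertex → Prop} {u v : HexVertex}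
    (h : Linked S u v) (h0 : P u)
    (hstep : ∀ x y, x ∈ S → y ∈ S → hexGraph.Adj x y → Linked S u x → P x → P y) : P v := by
  obtain ⟨hu, hv, ⟨p⟩⟩ := h
  suffices H : ∀ (s t : ↥S) (q : (hexGraph.induce S).Walk s t), Linked S u s.1 → P s.1 → P t.1 from
    H ⟨u, hu⟩ ⟨v, hv⟩ p (Linked.refl hu) h0
  intro s t q
  induction q with
  | nil => exact fun _ hP => hP
  | @cons x y _ hadj q ih =>
    intro hl hP
    have hxy : hexGraph.Adj x.1 y.1 := by simpa [SimpleGraph.comap_adj] using hadj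
    have hly : Linked S u y.1 := hl.trans (linked_of_adj x.2 y.2 hxy)
    exact ih hly (hstep x.1 y.1 x.2 y.2 hxy hl hP)

/-- Linkage inside `Λ` from `w` is linkage inside the component of `w`. [folklore] -/
theorem linked_comp {Λ : Finset HexVertex} {w v : HexVertex} (h : Linked (↑Λ : Set HexVertex) w v) :
    Linked (↑(comp Λ w) : Set HexVertex) w v := by
  have hwΛ : w ∈ Λ := by exact_mod_cast h.mem_left
  have hw : w ∈ (↑(comp Λ w) : Set HexVertex) := by exact_mod_cast self_mem_comp hwΛ
  refine h.induct (P := fun v => Linked (↑(comp Λ w) : Set HexVertex) w v) (Linked.refl hw) ?_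
  intro x y hx hy hxy hlx hPx
  have hy' : y ∈ (↑(comp Λ w) : Set HexVertex) := by
    have : y ∈ comp Λ w := mem_comp.2 ⟨by exact_mod_cast hy, hlx.trans (linked_of_adj hx hy hxy)⟩
    exact_mod_cast this
  exact hPx.trans (linked_of_adj hPx.mem_right hy' hxy)

/-- The component is connected. [folklore] -/
theorem preconnected_comp (Λ : Finset HexVertex) (w : HexVertex) :
    (hexGraph.induce (↑(comp Λ w) : Set HexVertex)).Preconnected :=
  preconnected_of_linked fun _ hu _ hv =>
    (linked_comp (mem_comp.1 (by exact_mod_cast hu)).2).symm.trans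
      (linked_comp (mem_comp.1 (by exact_mod_cast hv)).2)

/-- Along a chain of adjacent vertices of `Λ`, every vertex is linked to the first. [folklore] -/
theorem chain_linked {Λ : Finset HexVertex} :
    ∀ (l : List HexVertex) (x : HexVertex), (x :: l).IsChain hexGraph.Adj →
      (∀ v ∈ x :: l, v ∈ Λ) → ∀ v ∈ x :: l, Linked (↑Λ : Set HexVertex) x v := by
  intro l
  induction l with
  | nil =>
    intro x _ hmem v hv
    rw [List.mem_singleton] at hv
    subst hv
    exact Linked.refl (by exact_mod_cast hmem v (by simp))
  | cons y l ih =>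
    intro x hch hmem v hv
    have hxy : hexGraph.Adj x y := (List.isChain_cons_cons.1 hch).1
    have hch' : (y :: l).IsChain hexGraph.Adj := (List.isChain_cons_cons.1 hch).2
    have hx : x ∈ Λ := hmem x (by simp)
    have hy : y ∈ Λ := hmem y (by simp)
    rcases List.mem_cons.1 hv with rfl | hv
    · exact Linked.refl (by exact_mod_cast hx)
    · exact (linked_of_adj (by exact_mod_cast hx) (by exact_mod_cast hy) hxy).trans
        (ih y hch' (fun u hu => hmem u (List.mem_cons_of_mem _ hu)) v hv)

/-- A walk from the root mid-edge `s(u, w)` (`u ∉ Λ`) visits only vertices linked to `w`. [folklore] -/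
theorem verts_linked {Λ : Finset HexVertex} {u w : HexVertex} {z : Sym2 HexVertex} (hu : u ∉ Λ)
    (γ : HexMidEdgeSAW Λ s(u, w) z) : ∀ v ∈ γ.verts, Linked (↑Λ : Set HexVertex) w v := by
  intro v hv
  obtain ⟨x, l, hxl⟩ := List.exists_cons_of_ne_nil (List.ne_nil_of_mem hv)
  have hx : x ∈ s(u, w) := γ.head_mem x (by rw [hxl]; rfl)
  have hxΛ : x ∈ Λ := γ.subset x (by rw [hxl]; simp)
  have hxw : x = w := by
    rcases Sym2.mem_iff.1 hx with rfl | rfl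
    · exact absurd hxΛ hu
    · rfl
  subst hxw
  have hch : (x :: l).IsChain hexGraph.Adj := hxl ▸ γ.isChain
  exact chain_linked l x hch (fun v hv' => γ.subset v (hxl ▸ hv')) v (hxl ▸ hv)

/-- Transport of a walk from the root `s(u,w)` into the component of `w`. [folklore] -/
noncomputable def toComp {Λ : Finset HexVertex} {u w : HexVertex} {z : Sym2 HexVertex} (hu : u ∉ Λ)
    (hw : w ∈ Λ) (huw : hexGraph.Adj u w) (γ : HexMidEdgeSAW Λ s(u, w) z) :
    HexMidEdgeSAW (comp Λ w) s(u, w) z where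
  verts := γ.verts
  subset := fun v hv => mem_comp.2 ⟨γ.subset v hv, verts_linked hu γ v hv⟩
  nodup := γ.nodup
  isChain := γ.isChain
  head_mem := γ.head_mem
  getLast_mem := γ.getLast_mem
  eq_of_nil := γ.eq_of_nil
  edges_nodup := γ.edges_nodup
  fst_mem := ⟨(SimpleGraph.mem_edgeSet _).2 huw, w, Sym2.mem_mk_right _ _, self_mem_comp hw⟩

/-- Transport of a walk of a sub-domain to the big domain. [folklore] -/
def ofSubdomain {Λ Λ' : Finset HexVertex} (hsub : Λ' ⊆ Λ) {a z : Sym2 HexVertex}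
    (γ : HexMidEdgeSAW Λ' a z) : HexMidEdgeSAW Λ a z where
  verts := γ.verts
  subset := fun v hv => hsub (γ.subset v hv)
  nodup := γ.nodup
  isChain := γ.isChain
  head_mem := γ.head_mem
  getLast_mem := γ.getLast_mem
  eq_of_nil := γ.eq_of_nil
  edges_nodup := γ.edges_nodup
  fst_mem := by
    obtain ⟨he, v, hv, hvΛ⟩ := γ.fst_mem
    exact ⟨he, v, hv, hsub hvΛ⟩

/-- **The observable does not see the other components**: from the root `s(u,w)` (`u ∉ Λ`, `w ∈ Λ`),
`F_{Λ}(z) = F_{comp Λ w}(z)` for every fugacity, spin and target. [folklore] -/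
theorem observable_comp_eq {Λ : Finset HexVertex} {u w : HexVertex} (hu : u ∉ Λ) (hw : w ∈ Λ)
    (huw : hexGraph.Adj u w) (x σ : ℝ) (z : Sym2 HexVertex) :
    hexParafermionicObservable (comp Λ w) s(u, w) x σ z = hexParafermionicObservable Λ s(u, w) x σ z := by
  let e : HexMidEdgeSAW (comp Λ w) s(u, w) z ≃ HexMidEdgeSAW Λ s(u, w) z :=
    { toFun := ofSubdomain (comp_subset Λ w)
      invFun := toComp hu hw huw
      left_inv := fun γ => HexMidEdgeSAW.ext rfl
      right_inv := fun γ => HexMidEdgeSAW.ext rfl }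
  unfold hexParafermionicObservable
  exact Fintype.sum_equiv e _ _ fun γ => rfl

/-! ### M.2 Simple connectivity passes to the component -/

/-- Every vertex outside the component is linked, outside the component, to a vertex outside `Λ`
(walk right along its row until leaving the finite set `Λ`). [folklore] -/
theorem linked_compl_comp_to_compl {Λ : Finset HexVertex} {w v : HexVertex} (hv : v ∉ comp Λ w) :
    ∃ y, y ∉ Λ ∧ Linked ((↑(comp Λ w) : Set HexVertex)ᶜ) v y := by
  classical
  -- some vertex of the row of `v`, to the right, is outside `Λ`
  have hex : ∃ n : ℕ, bv (row v) (pos v + n) ∉ Λ := by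
    by_contra hall
    simp only [not_exists, not_not] at hall
    have hinj : Function.Injective (fun n : ℕ => bv (row v) (pos v + n)) := by
      intro i j hij
      have := (bv_inj hij).2
      exact_mod_cast (add_left_cancel this)
    exact (Set.infinite_of_injective_forall_mem hinj (fun n => (hall n : _ ∈ (↑Λ : Set HexVertex))))
      (Finset.finite_toSet Λ)
  let n₀ := Nat.find hex
  have hn₀ : bv (row v) (pos v + n₀) ∉ Λ := Nat.find_spec hex
  have hlt : ∀ k : ℕ, k < n₀ → bv (row v) (pos v + k) ∈ Λ := fun k hk => by
    have := Nat.find_min hex hk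
    simpa using this
  -- the run stays outside the component: a vertex of the run inside the component would drag `v` in
  have hrun : ∀ k : ℕ, k ≤ n₀ → bv (row v) (pos v + k) ∈ ((↑(comp Λ w) : Set HexVertex)ᶜ) := by
    intro k hk hk'
    have hk'' : bv (row v) (pos v + k) ∈ comp Λ w := by exact_mod_cast hk'
    rcases Nat.lt_or_ge k n₀ with hkn | hkn
    · -- linked back to `v` inside `Λ`
      have hlink : Linked (↑Λ : Set HexVertex) (bv (row v) (pos v)) (bv (row v) (pos v + k)) :=
        linked_run (row v) (pos v) k fun i hi => by exact_mod_cast hlt i (by omega)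
      rw [bv_row_pos] at hlink
      have h0 : v ∈ Λ := by
        have h0 := hlt 0 (by omega)
        rwa [show pos v + ((0 : ℕ) : ℤ) = pos v by simp, bv_row_pos] at h0
      exact hv (mem_comp.2 ⟨h0, ((mem_comp.1 hk'').2.trans hlink.symm)⟩)
    · have : k = n₀ := le_antisymm hk hkn
      subst this
      exact hn₀ (comp_subset Λ w hk'')
  refine ⟨bv (row v) (pos v + n₀), hn₀, ?_⟩
  have := linked_run (S := ((↑(comp Λ w) : Set HexVertex)ᶜ)) (row v) (pos v) n₀ hrun
  rwa [bv_row_pos] at this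

/-- **Simple connectivity passes to the component.** [folklore] -/
theorem simplyConnected_comp {Λ : Finset HexVertex} (hΛ : hexDomainSimplyConnected Λ) (w : HexVertex) :
    hexDomainSimplyConnected (comp Λ w) := by
  refine preconnected_of_linked fun x hx y hy => ?_
  have hx' : x ∉ comp Λ w := fun h => hx (by exact_mod_cast h)
  have hy' : y ∉ comp Λ w := fun h => hy (by exact_mod_cast h)
  obtain ⟨x₁, hx₁, hlx⟩ := linked_compl_comp_to_compl hx'
  obtain ⟨y₁, hy₁, hly⟩ := linked_compl_comp_to_compl hy'
  have hsub : ((↑Λ : Set HexVertex)ᶜ) ⊆ ((↑(comp Λ w) : Set HexVertex)ᶜ) :=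
    Set.compl_subset_compl.2 (by exact_mod_cast comp_subset Λ w)
  have hmid : Linked ((↑Λ : Set HexVertex)ᶜ) x₁ y₁ :=
    ⟨by exact_mod_cast hx₁, by exact_mod_cast hy₁, hΛ ⟨x₁, by exact_mod_cast hx₁⟩ ⟨y₁, by exact_mod_cast hy₁⟩⟩
  exact (hlx.trans (hmid.mono hsub)).trans hly.symm

/-! ### M.3 Boundary mid-edges and the SAW pass to the component -/

/-- The root stays a boundary mid-edge. [folklore] -/
theorem root_mem_boundary_comp {Λ : Finset HexVertex} {u w : HexVertex} (hu : u ∉ Λ) (hw : w ∈ Λ)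
    (huw : hexGraph.Adj u w) : s(u, w) ∈ hexDomainBoundary (comp Λ w) :=
  ⟨(SimpleGraph.mem_edgeSet _).2 huw, u, w, rfl, self_mem_comp hw, fun h => hu (comp_subset Λ w h)⟩

/-- A boundary target reached by a walk from the root stays a boundary mid-edge. [folklore] -/
theorem target_mem_boundary_comp {Λ : Finset HexVertex} {u w p q : HexVertex} (hu : u ∉ Λ)
    (hw : w ∈ Λ) (hp : p ∉ Λ) (hq : q ∈ Λ) (hpq : hexGraph.Adj p q)
    (γ : HexMidEdgeSAW Λ s(u, w) s(p, q)) : s(p, q) ∈ hexDomainBoundary (comp Λ w) := by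
  refine ⟨(SimpleGraph.mem_edgeSet _).2 hpq, p, q, rfl, ?_, fun h => hp (comp_subset Λ w h)⟩
  -- `q` is linked to `w`: either the walk is trivial (`{p,q} = {u,w}`, so `q = w`) or its last vertex is `q`
  by_cases hnil : γ.verts = []
  · have heq : s(u, w) = s(p, q) := γ.eq_of_nil hnil
    have hq' : q ∈ s(u, w) := by rw [heq]; exact Sym2.mem_mk_right _ _
    rcases Sym2.mem_iff.1 hq' with rfl | rfl
    · exact absurd hq hu
    · exact self_mem_comp hw
  · have hlast : γ.verts.getLast hnil ∈ s(p, q) :=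
      γ.getLast_mem _ (List.getLast?_eq_some_getLast hnil)
    have hlastΛ : γ.verts.getLast hnil ∈ Λ := γ.subset _ (List.getLast_mem hnil)
    have hlq : γ.verts.getLast hnil = q := by
      rcases Sym2.mem_iff.1 hlast with h | h
      · exact absurd (h ▸ hlastΛ) hp
      · exact h
    exact mem_comp.2 ⟨hq, hlq ▸ verts_linked hu γ _ (List.getLast_mem hnil)⟩

/-- The SAW passes to the component. [folklore] -/
theorem nonempty_saw_comp {Λ : Finset HexVertex} {u w : HexVertex} {z : Sym2 HexVertex} (hu : u ∉ Λ)
    (hw : w ∈ Λ) (huw : hexGraph.Adj u w) (h : Nonempty (HexMidEdgeSAW Λ s(u, w) z)) :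
    Nonempty (HexMidEdgeSAW (comp Λ w) s(u, w) z) :=
  ⟨toComp hu hw huw h.some⟩

end Summit.CriticalPhenomena.SAWScalingLimit.Theorems.MassRatio.Negative
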